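import Summits.BirchSwinnertonDyer.BirchSwinnertonDyer.Theorems.ByReductionTypeAtTwoRankOneAtTwoOneDoorLawSubsliceDefs
import Summits.BirchSwinnertonDyer.BirchSwinnertonDyer.Theorems.ByReductionTypeAtTwoRankOneAtTwoBigImageOddLocalOneDoorBottomSubslice
import Summits.BirchSwinnertonDyer.BirchSwinnertonDyer.Theorems.ByReductionTypeAtTwoRankOneAtTwoBigImageOddLocalOneDoorBottomOfPrintCTFree
import Summits.BirchSwinnertonDyer.BirchSwinnertonDyer.Theorems.ByReductionTypeAtTwoRankOneAtTwoBigImageOddLocalOneDoorHalvesBookkeeping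
import HarnessLib

/-!
# Route ByReductionTypeAtTwo, crux `RankOneAtTwoBigImageOddLocal` (stmt-BirchSwinnertonDyer-23715), LINE v8.14 `one_door_analytic`:
# THE SUB-SLICE SPLIT — the crux from ONE ∀∃ residue off the proved sub-slice, and the reshape is lossless

Lead prover seat `bsd-line-fkl-p1` g15 (2026-08-28), `--supports stmt-BirchSwinnertonDyer-23715` (helper).  THEOREMS ONLY; no definition,
no named fact introduced, no `sorry`; every statement is CONDITIONAL on PRINT named facts of the tree (Gross–Zagier `gross_zagier`,
Kolyvagin `kolyvagin`, modularity as a newform `exists_isNewformOf`, Hoffstein–Luo 1997 `HoffsteinLuo1997_exists_twist_L_one_ne_zero`,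
Gross 1991 Prop. 3.7 (2) `GrossLMS1991.prop37_2_frobeniusCongruence`) and on rank-`0` `BSD₂` of the twins (`S_rankZeroTwin`, or the
route's four `…RankZeroAtTwo` cruxes BY NAME).  BSD is not proved by any of this.

What this file proves (statements in `Theorems/…OneDoorLawSubsliceDefs.lean`, APPEND #8):

* §1 `bsdp_two_of_hasLawfulDoorAtTwo` — ONE lawful door datum of `W` (a non-vanishing admissible door datum and an exponent at which
  the AN-28c identity holds) gives `BSDp W 2`: the per-datum kernel iff `bsdp_two_iff_doorLawFullC_at_of_rank` read from right to left,
  the twin's `BSDp Wd 2` from rank-`0` `BSD₂` (the twist model is non-CM of analytic rank `0`).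
* §2 `exists_doorDatum_of_analyticRank_eq_one` — every `W` of analytic rank `1` HAS a non-vanishing admissible door datum
  (Hoffstein–Luo door, modularity datum of any constant, `K`-rational Heegner point, globally minimal twist model); hence
  `hasLawfulDoorAtTwo_of_bsdp_two` — `BSDp W 2` makes EVERY such datum lawful (kernel iff left to right): lawful doors and `BSD₂` are
  the same thing on the slice, modulo print and rank-`0` `BSD₂`.
* §3 THE COMPOSITION of skeleton v8.14: `rankOneAtTwoBigImageOddLocal_of_someDoorOffSubslice` — the crux BY NAME from the five
  printed facts, the ONE residue `DoorIndexLawFullCAtTwoSomeDoorOffSubslice` and the four rank-`0` cruxes, by a case split on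
  `HasBottomRungDoorAtTwo W` (yes: the bottom rung U₀ from print, `doorIndexLawUpperCAtTwoBottom_of_print_ctFree`, makes the datum lawful
  with `m = 0`; no: the residue supplies a lawful datum); and `rankOneAtTwoBigImageOddLocal_of_someDoor` from the hypothesis-free form
  with only FOUR printed facts (no Gross 3.7 (2)).
* §4 LOSSLESS: `doorIndexLawFullCAtTwo_of_rankOneAtTwoBigImageOddLocal` (the crux gives AN-28c at EVERY datum), hence
  `doorIndexLawFullCAtTwo_of_someDoorOffSubslice`, `doorIndexLawUpperCAtTwoOffBottom_of_someDoorOffSubslice`,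
  `doorIndexLawLowerCAtTwo_of_someDoorOffSubslice` — v8.14's one stub implies v8.13's two; and conversely
  `doorIndexLawFullCAtTwoSomeDoor_of_offBottom_of_lowerC` — v8.13's two stubs imply v8.14's (even the hypothesis-free form).

So the conjecture-grade content of LINE `one_door_analytic` is exactly ONE ∀∃ statement: every curve of the slice without a bottom-rung
door datum has SOME door datum where the Heegner index, `Ш(W)[2^∞]`, `Ш(Wd)[2^∞]` and the door's local terms balance.

References: [GrossLMS1991] §§2–3, §10, Prop. 3.7 (2); [Kolyvagin1990] Thm. A; [GrossZagier1986] Thm. I.6.3, V.§2; [HoffsteinLuo1997];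
[MazurRubin2010] Cor. 3.4 (i); [Nekovar2007] Prop. 4.9.
-/

set_option autoImplicit false
-- the Theorems namespace of this sub repeats the summit name by design (D-0017 nested layout)
set_option linter.dupNamespace false

noncomputable section

open scoped Classical

namespace Summit.BirchSwinnertonDyer.BirchSwinnertonDyer.Theorems.RankOneAtTwoOneDoor

open WeierstrassCurve NumberField Literature.NumberTheory.EllipticCurves Literature.NumberTheory.EllipticCurves.ModularForms
  Summit.BirchSwinnertonDyer.BirchSwinnertonDyer.Theses.ByReductionTypeAtTwo

/-! ### §1 One lawful door datum gives `BSD₂(W)` -/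

/-- **`BSDp W 2` FROM ONE LAWFUL DOOR DATUM, modulo print and rank-`0` `BSD₂` of non-CM curves.**  `W/ℚ` globally minimal, non-CM, odd
torsion order, odd Tamagawa product, analytic rank `1`, admitting a lawful door datum (`HasLawfulDoorAtTwo W`).  THEN `BSDp W 2` — from
Gross–Zagier, Kolyvagin, modularity, Hoffstein–Luo (named facts, as hypotheses; `rank E(ℚ) = 1` from them) and `S_rankZeroTwin` (the twist
model `Wd` is non-CM by `j`-invariance and of analytic rank `0` since `L(Wd,1) = L(W^{(d_K)},1) ≠ 0`): the per-datum equivalence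
`bsdp_two_iff_doorLawFullC_at_of_rank` read from right to left at the lawful datum.  CONDITIONAL by design; BSD is not proved by this.
[cite: GrossZagier1986, Thm. I.6.3 and V.§2] [cite: GrossLMS1991, Conj. 1.2 and §3] [cite: Kolyvagin1990, Thm. A] -/
theorem bsdp_two_of_hasLawfulDoorAtTwo
    (hGZ : ∀ (N : ℕ) [NeZero N] (W : WeierstrassCurve ℚ) (K : Type) [Field K] [NumberField K], gross_zagier N W K)
    (hKo : ∀ (N : ℕ) [NeZero N] (W : WeierstrassCurve ℚ) (K : Type) [Field K] [NumberField K], kolyvagin N W K)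
    (hnf : exists_isNewformOf) (hHL : HoffsteinLuo1997_exists_twist_L_one_ne_zero) (hZ : S_rankZeroTwin)
    (W : WeierstrassCurve ℚ) [W.IsElliptic] [W.IsGloballyMinimal] [NeZero (W.conductorNorm ℤ)]
    (hCM : ¬ W.HasCM) (hT : Odd W.torsionOrder) (hc : Odd W.tamagawaProduct) (hr : W.analyticRank = 1)
    (hlawful : HasLawfulDoorAtTwo W) : BSDp W 2 := by
  have hmod : hasEntireLFunction_rat := hasEntireLFunction_rat_of_exists_isNewformOf hnf
  have hrk : W.mordellWeilRank = 1 :=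
    (mordellWeilRank_eq_one_of_analyticRank_eq_one_of_isGloballyMinimal hGZ hKo hnf hHL W hr).1
  unfold HasLawfulDoorAtTwo at hlawful
  obtain ⟨K, iF, iN, hK, hadm, hLt, Dt, H, ι, P, Wd, iE, iM, Cd, hP, hWd, m, hm, hlaw⟩ := hlawful
  have hHN : SatisfiesHeegnerHypothesis (W.conductorNorm ℤ) K := satisfiesHeegnerHypothesis_of_doorAdmissible W K hK hadm
  -- the twist model: non-CM, analytic rank `0`, hence `BSDp Wd 2`
  have hD0 : (NumberField.discr K : ℚ) ≠ 0 := by exact_mod_cast NumberField.discr_ne_zero K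
  haveI hEt : (W.quadraticTwist (NumberField.discr K : ℚ)).IsElliptic := W.isElliptic_quadraticTwist hD0
  have hCMd : ¬ Wd.HasCM := RamifiedPairUpperBound.not_hasCM_of_smul_quadraticTwist_eq hD0 hWd hCM
  have hLeq : Wd.entireLFunction = (W.quadraticTwist (NumberField.discr K : ℚ)).entireLFunction := by
    rw [← hWd, entireLFunction_smul]
  have hrd : Wd.analyticRank = 0 :=
    (Wd.analyticRank_eq_zero_iff_holds (hmod Wd)).2 (by rw [hLeq]; exact hLt)
  have hBd : BSDp Wd 2 := hZ Wd hCMd hrd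
  -- the per-datum equivalence, right to left
  obtain ⟨-, -, hiff⟩ :=
    bsdp_two_iff_doorLawFullC_at_of_rank hmod doorTwistTamagawaAtTwo W hT hc hr hrk K hK (hGZ _ W K) (hKo _ W K) hadm hHN hLt
      Dt H ι P hP Wd Cd hWd hBd
  exact hiff.mpr ⟨m, hm, hlaw⟩

/-- **`BSDp W 2` from one lawful door datum, the twin's `BSD₂` from the route's four rank-`0` cruxes BY NAME**
(`bsdp_two_of_rankZero_cruxes`).  CONDITIONAL by design; BSD is not proved by this. [cite: GrossLMS1991, Conj. 1.2 and §3]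
[cite: Kolyvagin1990, Thm. A] -/
theorem bsdp_two_of_hasLawfulDoorAtTwo_of_rankZero_cruxes
    (hGZ : ∀ (N : ℕ) [NeZero N] (W : WeierstrassCurve ℚ) (K : Type) [Field K] [NumberField K], gross_zagier N W K)
    (hKo : ∀ (N : ℕ) [NeZero N] (W : WeierstrassCurve ℚ) (K : Type) [Field K] [NumberField K], kolyvagin N W K)
    (hnf : exists_isNewformOf) (hHL : HoffsteinLuo1997_exists_twist_L_one_ne_zero)
    (hZ4 : GoodOrdinaryRankZeroAtTwo ∧ MultiplicativeRankZeroAtTwo ∧ SupersingularRankZeroAtTwo ∧ AdditiveRankZeroAtTwo)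
    (W : WeierstrassCurve ℚ) [W.IsElliptic] [W.IsGloballyMinimal] [NeZero (W.conductorNorm ℤ)]
    (hCM : ¬ W.HasCM) (hT : Odd W.torsionOrder) (hc : Odd W.tamagawaProduct) (hr : W.analyticRank = 1)
    (hlawful : HasLawfulDoorAtTwo W) : BSDp W 2 :=
  bsdp_two_of_hasLawfulDoorAtTwo hGZ hKo hnf hHL (fun V _ _ hVCM hV0 => bsdp_two_of_rankZero_cruxes hZ4 V hVCM hV0)
    W hCM hT hc hr hlawful

/-! ### §2 Every curve of analytic rank one HAS a non-vanishing admissible door datum; `BSD₂(W)` makes it lawful -/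

/-- **A non-vanishing admissible door datum EXISTS for every `W` of analytic rank `1`**, from modularity as a newform and
Hoffstein–Luo (named facts, as hypotheses): the door field `K` (`doorSupplyAnalyticAtTwo_of_hoffsteinLuo`: `d_K` door-admissible,
`L(W^{(d_K)},1) ≠ 0`, Heegner hypothesis), a parametrisation datum `Dt` of level `N_W` of any constant
(`nonempty_modularParametrizationData_iff_exists_isNewformOf_unconditional`), `H` (`nonempty_heegnerDatum_holds`), an embedding `ι`,
a `K`-rational point over the complex Heegner point (`heegnerPointComplex_mem_range_map_holds`), and a globally minimal model of the
twist (`hasGlobalMinimalModel_rat_holds`).  CONDITIONAL by design. [cite: HoffsteinLuo1997, Theorem (§1, pp. 435–436)]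
[cite: GrossZagier1986, Thm. I.6.3 and V.§2] -/
theorem exists_doorDatum_of_analyticRank_eq_one (hnf : exists_isNewformOf) (hHL : HoffsteinLuo1997_exists_twist_L_one_ne_zero)
    (W : WeierstrassCurve ℚ) [W.IsElliptic] [W.IsGloballyMinimal] [NeZero (W.conductorNorm ℤ)] (hr : W.analyticRank = 1) :
    ∃ (K : Type) (_ : Field K) (_ : NumberField K), IsImaginaryQuadratic K ∧ DoorAdmissible W (NumberField.discr K) ∧
      (W.quadraticTwist (NumberField.discr K : ℚ)).entireLFunction 1 ≠ 0 ∧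
      ∃ (Dt : ModularParametrizationData W (W.conductorNorm ℤ)) (H : HeegnerDatum (W.conductorNorm ℤ) (NumberField.discr K))
        (ι : K →+* ℂ) (P : (W.baseChange K).toAffine.Point) (Wd : WeierstrassCurve ℚ) (_ : Wd.IsElliptic) (_ : Wd.IsGloballyMinimal)
        (Cd : WeierstrassCurve.VariableChange ℚ),
        WeierstrassCurve.Affine.Point.map ι.toRatAlgHom P = heegnerPointComplex Dt H ∧
          Cd • W.quadraticTwist (NumberField.discr K : ℚ) = Wd := by
  -- the door field (Waldspurger–Hoffstein–Luo): admissible, `L(E^{(d_K)},1) ≠ 0`, Heegner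
  obtain ⟨K, iF, iN, hK, hadm, hLt, -, hHN⟩ := doorSupplyAnalyticAtTwo_of_hoffsteinLuo hnf hHL W hr
  -- ANY parametrisation datum at level `N_E` (modularity), `H`, `ι`, the `K`-rational point
  obtain ⟨Dt⟩ := (nonempty_modularParametrizationData_iff_exists_isNewformOf_unconditional.mpr hnf) W
  obtain ⟨H, -⟩ :=
    nonempty_heegnerDatum_holds (W.conductorNorm ℤ) K hK (exists_dvd_sq_sub_discr_holds (W.conductorNorm ℤ) K hK hHN).choose_spec
  obtain ⟨ι⟩ : Nonempty (K →+* ℂ) := inferInstance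
  obtain ⟨P, hP⟩ := heegnerPointComplex_mem_range_map_holds (W.conductorNorm ℤ) W K hK hHN Dt H ι
  -- a globally minimal model of the twist
  have hD0 : (NumberField.discr K : ℚ) ≠ 0 := by exact_mod_cast NumberField.discr_ne_zero K
  haveI hEt : (W.quadraticTwist (NumberField.discr K : ℚ)).IsElliptic := W.isElliptic_quadraticTwist hD0
  obtain ⟨Cd, hCd⟩ := hasGlobalMinimalModel_rat_holds (W.quadraticTwist (NumberField.discr K : ℚ))
  exact ⟨K, iF, iN, hK, hadm, hLt, Dt, H, ι, P, Cd • W.quadraticTwist (NumberField.discr K : ℚ), inferInstance, hCd, Cd, hP, rfl⟩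

/-- **`BSDp W 2` MAKES EVERY CURVE OF THE SLICE ADMIT A LAWFUL DOOR DATUM** (the converse of §1, modulo the same print and rank-`0`
`BSD₂`): take the datum of `exists_doorDatum_of_analyticRank_eq_one` and read the per-datum equivalence from left to right.  So on the
slice «`W` has a lawful door datum» and «`BSDp W 2`» are EQUIVALENT modulo Gross–Zagier, Kolyvagin, modularity, Hoffstein–Luo and
`S_rankZeroTwin`.  CONDITIONAL by design; BSD is not proved by this. [cite: GrossZagier1986, Thm. I.6.3 and V.§2]
[cite: GrossLMS1991, Conj. 1.2 and §3] -/
theorem hasLawfulDoorAtTwo_of_bsdp_two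
    (hGZ : ∀ (N : ℕ) [NeZero N] (W : WeierstrassCurve ℚ) (K : Type) [Field K] [NumberField K], gross_zagier N W K)
    (hKo : ∀ (N : ℕ) [NeZero N] (W : WeierstrassCurve ℚ) (K : Type) [Field K] [NumberField K], kolyvagin N W K)
    (hnf : exists_isNewformOf) (hHL : HoffsteinLuo1997_exists_twist_L_one_ne_zero) (hZ : S_rankZeroTwin)
    (W : WeierstrassCurve ℚ) [W.IsElliptic] [W.IsGloballyMinimal] [NeZero (W.conductorNorm ℤ)]
    (hCM : ¬ W.HasCM) (hT : Odd W.torsionOrder) (hc : Odd W.tamagawaProduct) (hr : W.analyticRank = 1) (hB : BSDp W 2) :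
    HasLawfulDoorAtTwo W := by
  have hmod : hasEntireLFunction_rat := hasEntireLFunction_rat_of_exists_isNewformOf hnf
  have hrk : W.mordellWeilRank = 1 :=
    (mordellWeilRank_eq_one_of_analyticRank_eq_one_of_isGloballyMinimal hGZ hKo hnf hHL W hr).1
  obtain ⟨K, iF, iN, hK, hadm, hLt, Dt, H, ι, P, Wd, iE, iM, Cd, hP, hWd⟩ :=
    exists_doorDatum_of_analyticRank_eq_one hnf hHL W hr
  have hHN : SatisfiesHeegnerHypothesis (W.conductorNorm ℤ) K := satisfiesHeegnerHypothesis_of_doorAdmissible W K hK hadm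
  have hD0 : (NumberField.discr K : ℚ) ≠ 0 := by exact_mod_cast NumberField.discr_ne_zero K
  haveI hEt : (W.quadraticTwist (NumberField.discr K : ℚ)).IsElliptic := W.isElliptic_quadraticTwist hD0
  have hCMd : ¬ Wd.HasCM := RamifiedPairUpperBound.not_hasCM_of_smul_quadraticTwist_eq hD0 hWd hCM
  have hLeq : Wd.entireLFunction = (W.quadraticTwist (NumberField.discr K : ℚ)).entireLFunction := by
    rw [← hWd, entireLFunction_smul]
  have hrd : Wd.analyticRank = 0 :=
    (Wd.analyticRank_eq_zero_iff_holds (hmod Wd)).2 (by rw [hLeq]; exact hLt)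
  have hBd : BSDp Wd 2 := hZ Wd hCMd hrd
  obtain ⟨-, -, hiff⟩ :=
    bsdp_two_iff_doorLawFullC_at_of_rank hmod doorTwistTamagawaAtTwo W hT hc hr hrk K hK (hGZ _ W K) (hKo _ W K) hadm hHN hLt
      Dt H ι P hP Wd Cd hWd hBd
  obtain ⟨m, hm, hlaw⟩ := hiff.mp hB
  unfold HasLawfulDoorAtTwo
  exact ⟨K, iF, iN, hK, hadm, hLt, Dt, H, ι, P, Wd, iE, iM, Cd, hP, hWd, m, hm, hlaw⟩

/-- **U₀ from print makes every bottom-rung datum lawful**: a curve of the slice with a bottom-rung door datum has a lawful door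
datum, from the five printed facts (Gross–Zagier, Kolyvagin, modularity, Hoffstein–Luo, Gross 1991 Prop. 3.7 (2)) through
`doorIndexLawUpperCAtTwoBottom_of_print_ctFree`.  CONDITIONAL by design. [cite: GrossLMS1991, §10 and Prop. 3.7 (2)] [cite: Kolyvagin1990, Thm. A]
[cite: MazurRubin2010, Cor. 3.4 (i)] -/
theorem hasLawfulDoorAtTwo_of_hasBottomRungDoorAtTwo_of_print
    (hGZ : ∀ (N : ℕ) [NeZero N] (W : WeierstrassCurve ℚ) (K : Type) [Field K] [NumberField K], gross_zagier N W K)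
    (hKo : ∀ (N : ℕ) [NeZero N] (W : WeierstrassCurve ℚ) (K : Type) [Field K] [NumberField K], kolyvagin N W K)
    (hnf : exists_isNewformOf) (hHL : HoffsteinLuo1997_exists_twist_L_one_ne_zero)
    (h37 : Literature.NumberTheory.EllipticCurves.GrossLMS1991.prop37_2_frobeniusCongruence)
    (W : WeierstrassCurve ℚ) [W.IsElliptic] [W.IsGloballyMinimal] [NeZero (W.conductorNorm ℤ)]
    (hCM : ¬ W.HasCM) (hsurj : ∀ n : ℕ, W.HasSurjectiveModNGaloisRep ((2 ^ n : ℕ) : ℤ)) (hT : Odd W.torsionOrder)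
    (hc : Odd W.tamagawaProduct) (hr : W.analyticRank = 1) (hdoor : HasBottomRungDoorAtTwo W) : HasLawfulDoorAtTwo W :=
  hasLawfulDoorAtTwo_of_bottomRung_of_doorIndexLawUpperCAtTwoBottom (doorIndexLawUpperCAtTwoBottom_of_print_ctFree hGZ hKo hnf hHL h37)
    W hCM hsurj hT hc hr hdoor

/-! ### §3 The composition of skeleton v8.14: the crux from the ONE residue -/

/-- **THE CRUX `RankOneAtTwoBigImageOddLocal` BY NAME FROM LINE v8.14's INPUTS**: the five printed facts Gross–Zagier (`gross_zagier`),
Kolyvagin (`kolyvagin`), modularity as a newform (`exists_isNewformOf`), Hoffstein–Luo 1997 (`HoffsteinLuo1997_exists_twist_L_one_ne_zero`),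
Gross 1991 Prop. 3.7 (2) (`GrossLMS1991.prop37_2_frobeniusCongruence`); the ONE conjecture-grade residue
`DoorIndexLawFullCAtTwoSomeDoorOffSubslice` (load-bearing); and the route's four rank-`0` cruxes at `2` BY NAME.  Case split on
`HasBottomRungDoorAtTwo W`: on the sub-slice the bottom rung U₀ from print makes the datum lawful with `m = 0`; off it the residue
supplies a lawful datum; either way `bsdp_two_of_hasLawfulDoorAtTwo`.  BSD is not proved by this: conditional by design.
[cite: GrossLMS1991, §10 and Conj. 1.2] [cite: Kolyvagin1990, Thm. A] [cite: GrossZagier1986, Thm. I.6.3 and V.§2] -/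
theorem rankOneAtTwoBigImageOddLocal_of_someDoorOffSubslice
    (hGZ : ∀ (N : ℕ) [NeZero N] (W : WeierstrassCurve ℚ) (K : Type) [Field K] [NumberField K], gross_zagier N W K)
    (hKo : ∀ (N : ℕ) [NeZero N] (W : WeierstrassCurve ℚ) (K : Type) [Field K] [NumberField K], kolyvagin N W K)
    (hnf : exists_isNewformOf) (hHL : HoffsteinLuo1997_exists_twist_L_one_ne_zero)
    (h37 : Literature.NumberTheory.EllipticCurves.GrossLMS1991.prop37_2_frobeniusCongruence)
    (hR : DoorIndexLawFullCAtTwoSomeDoorOffSubslice)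
    (hZ4 : GoodOrdinaryRankZeroAtTwo ∧ MultiplicativeRankZeroAtTwo ∧ SupersingularRankZeroAtTwo ∧ AdditiveRankZeroAtTwo) :
    RankOneAtTwoBigImageOddLocal := by
  intro W _ _ hCM hsurj hT hc hr
  haveI hN : NeZero (W.conductorNorm ℤ) := ⟨(W.conductorNorm_pos_holds).ne'⟩
  have hSome : DoorIndexLawFullCAtTwoSomeDoor :=
    doorIndexLawFullCAtTwoSomeDoor_of_offSubslice_of_bottom hR (doorIndexLawUpperCAtTwoBottom_of_print_ctFree hGZ hKo hnf hHL h37)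
  exact bsdp_two_of_hasLawfulDoorAtTwo_of_rankZero_cruxes hGZ hKo hnf hHL hZ4 W hCM hT hc hr (hSome W hCM hsurj hT hc hr)

/-- The same with `S_rankZeroTwin` (rank-`0` `BSD₂` for non-CM curves) in place of the four route items.  Conditional by design.
[cite: GrossLMS1991, §10 and Conj. 1.2] [cite: Kolyvagin1990, Thm. A] -/
theorem rankOneAtTwoBigImageOddLocal_of_someDoorOffSubslice'
    (hGZ : ∀ (N : ℕ) [NeZero N] (W : WeierstrassCurve ℚ) (K : Type) [Field K] [NumberField K], gross_zagier N W K)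
    (hKo : ∀ (N : ℕ) [NeZero N] (W : WeierstrassCurve ℚ) (K : Type) [Field K] [NumberField K], kolyvagin N W K)
    (hnf : exists_isNewformOf) (hHL : HoffsteinLuo1997_exists_twist_L_one_ne_zero)
    (h37 : Literature.NumberTheory.EllipticCurves.GrossLMS1991.prop37_2_frobeniusCongruence)
    (hR : DoorIndexLawFullCAtTwoSomeDoorOffSubslice) (hZ : S_rankZeroTwin) : RankOneAtTwoBigImageOddLocal := by
  intro W _ _ hCM hsurj hT hc hr
  haveI hN : NeZero (W.conductorNorm ℤ) := ⟨(W.conductorNorm_pos_holds).ne'⟩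
  have hSome : DoorIndexLawFullCAtTwoSomeDoor :=
    doorIndexLawFullCAtTwoSomeDoor_of_offSubslice_of_bottom hR (doorIndexLawUpperCAtTwoBottom_of_print_ctFree hGZ hKo hnf hHL h37)
  exact bsdp_two_of_hasLawfulDoorAtTwo hGZ hKo hnf hHL hZ W hCM hT hc hr (hSome W hCM hsurj hT hc hr)

/-- **The crux from the HYPOTHESIS-FREE residue with only FOUR printed facts** (no Gross 3.7 (2): no bottom rung is needed when every
curve of the slice is given a lawful datum directly).  Conditional by design. [cite: GrossLMS1991, Conj. 1.2 and §3] [cite: Kolyvagin1990, Thm. A] -/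
theorem rankOneAtTwoBigImageOddLocal_of_someDoor
    (hGZ : ∀ (N : ℕ) [NeZero N] (W : WeierstrassCurve ℚ) (K : Type) [Field K] [NumberField K], gross_zagier N W K)
    (hKo : ∀ (N : ℕ) [NeZero N] (W : WeierstrassCurve ℚ) (K : Type) [Field K] [NumberField K], kolyvagin N W K)
    (hnf : exists_isNewformOf) (hHL : HoffsteinLuo1997_exists_twist_L_one_ne_zero)
    (hS : DoorIndexLawFullCAtTwoSomeDoor)
    (hZ4 : GoodOrdinaryRankZeroAtTwo ∧ MultiplicativeRankZeroAtTwo ∧ SupersingularRankZeroAtTwo ∧ AdditiveRankZeroAtTwo) :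
    RankOneAtTwoBigImageOddLocal := by
  intro W _ _ hCM hsurj hT hc hr
  haveI hN : NeZero (W.conductorNorm ℤ) := ⟨(W.conductorNorm_pos_holds).ne'⟩
  exact bsdp_two_of_hasLawfulDoorAtTwo_of_rankZero_cruxes hGZ hKo hnf hHL hZ4 W hCM hT hc hr (hS W hCM hsurj hT hc hr)

/-! ### §4 The reshape is lossless (modulo the five printed facts and rank-`0` `BSD₂`) -/

/-- **The crux gives AN-28c at EVERY door datum** (kernel iff left to right, with `BSDp W 2` from the crux and `BSDp Wd 2` from
`S_rankZeroTwin`).  Conditional by design. [cite: GrossZagier1986, Thm. I.6.3 and V.§2] [cite: GrossLMS1991, Conj. 1.2 and §3] -/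
theorem doorIndexLawFullCAtTwo_of_rankOneAtTwoBigImageOddLocal
    (hGZ : ∀ (N : ℕ) [NeZero N] (W : WeierstrassCurve ℚ) (K : Type) [Field K] [NumberField K], gross_zagier N W K)
    (hKo : ∀ (N : ℕ) [NeZero N] (W : WeierstrassCurve ℚ) (K : Type) [Field K] [NumberField K], kolyvagin N W K)
    (hnf : exists_isNewformOf) (hHL : HoffsteinLuo1997_exists_twist_L_one_ne_zero) (hZ : S_rankZeroTwin)
    (hX : RankOneAtTwoBigImageOddLocal) : DoorIndexLawFullCAtTwo := by
  intro W _ _ _ hCM hsurj hT hc hr K _ _ hK hadm hLt Dt H ι P hP Wd _ _ Cd hWd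
  have hmod : hasEntireLFunction_rat := hasEntireLFunction_rat_of_exists_isNewformOf hnf
  have hrk : W.mordellWeilRank = 1 :=
    (mordellWeilRank_eq_one_of_analyticRank_eq_one_of_isGloballyMinimal hGZ hKo hnf hHL W hr).1
  have hHN : SatisfiesHeegnerHypothesis (W.conductorNorm ℤ) K := satisfiesHeegnerHypothesis_of_doorAdmissible W K hK hadm
  have hD0 : (NumberField.discr K : ℚ) ≠ 0 := by exact_mod_cast NumberField.discr_ne_zero K
  haveI hEt : (W.quadraticTwist (NumberField.discr K : ℚ)).IsElliptic := W.isElliptic_quadraticTwist hD0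
  have hCMd : ¬ Wd.HasCM := RamifiedPairUpperBound.not_hasCM_of_smul_quadraticTwist_eq hD0 hWd hCM
  have hLeq : Wd.entireLFunction = (W.quadraticTwist (NumberField.discr K : ℚ)).entireLFunction := by
    rw [← hWd, entireLFunction_smul]
  have hrd : Wd.analyticRank = 0 :=
    (Wd.analyticRank_eq_zero_iff_holds (hmod Wd)).2 (by rw [hLeq]; exact hLt)
  have hBd : BSDp Wd 2 := hZ Wd hCMd hrd
  obtain ⟨-, -, hiff⟩ :=
    bsdp_two_iff_doorLawFullC_at_of_rank hmod doorTwistTamagawaAtTwo W hT hc hr hrk K hK (hGZ _ W K) (hKo _ W K) hadm hHN hLt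
      Dt H ι P hP Wd Cd hWd hBd
  exact hiff.mp (hX W hCM hsurj hT hc hr)

/-- **v8.14's residue gives AN-28c at every datum** (through the crux).  Conditional by design: five printed facts and the four rank-`0`
cruxes. [cite: GrossLMS1991, Conj. 1.2, §3 and §10] [cite: Kolyvagin1990, Thm. A] -/
theorem doorIndexLawFullCAtTwo_of_someDoorOffSubslice
    (hGZ : ∀ (N : ℕ) [NeZero N] (W : WeierstrassCurve ℚ) (K : Type) [Field K] [NumberField K], gross_zagier N W K)
    (hKo : ∀ (N : ℕ) [NeZero N] (W : WeierstrassCurve ℚ) (K : Type) [Field K] [NumberField K], kolyvagin N W K)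
    (hnf : exists_isNewformOf) (hHL : HoffsteinLuo1997_exists_twist_L_one_ne_zero)
    (h37 : Literature.NumberTheory.EllipticCurves.GrossLMS1991.prop37_2_frobeniusCongruence)
    (hR : DoorIndexLawFullCAtTwoSomeDoorOffSubslice)
    (hZ4 : GoodOrdinaryRankZeroAtTwo ∧ MultiplicativeRankZeroAtTwo ∧ SupersingularRankZeroAtTwo ∧ AdditiveRankZeroAtTwo) :
    DoorIndexLawFullCAtTwo :=
  doorIndexLawFullCAtTwo_of_rankOneAtTwoBigImageOddLocal hGZ hKo hnf hHL
    (fun V _ _ hVCM hV0 => bsdp_two_of_rankZero_cruxes hZ4 V hVCM hV0)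
    (rankOneAtTwoBigImageOddLocal_of_someDoorOffSubslice hGZ hKo hnf hHL h37 hR hZ4)

/-- **v8.14's residue gives v8.13's Euler-system residue `DoorIndexLawUpperCAtTwoOffBottom`** (AN-28c at every datum, its upper half by
uniqueness of the exponent, then drop to the off-bottom data).  Conditional by design. [cite: Kolyvagin1990, Thm. A] [cite: GrossLMS1991, Conj. 1.2 and §3] -/
theorem doorIndexLawUpperCAtTwoOffBottom_of_someDoorOffSubslice
    (hGZ : ∀ (N : ℕ) [NeZero N] (W : WeierstrassCurve ℚ) (K : Type) [Field K] [NumberField K], gross_zagier N W K)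
    (hKo : ∀ (N : ℕ) [NeZero N] (W : WeierstrassCurve ℚ) (K : Type) [Field K] [NumberField K], kolyvagin N W K)
    (hnf : exists_isNewformOf) (hHL : HoffsteinLuo1997_exists_twist_L_one_ne_zero)
    (h37 : Literature.NumberTheory.EllipticCurves.GrossLMS1991.prop37_2_frobeniusCongruence)
    (hR : DoorIndexLawFullCAtTwoSomeDoorOffSubslice)
    (hZ4 : GoodOrdinaryRankZeroAtTwo ∧ MultiplicativeRankZeroAtTwo ∧ SupersingularRankZeroAtTwo ∧ AdditiveRankZeroAtTwo) :
    DoorIndexLawUpperCAtTwoOffBottom :=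
  doorIndexLawUpperCAtTwoOffBottom_of_doorIndexLawUpperCAtTwo
    (doorIndexLawUpperCAtTwo_of_full hGZ hKo hnf (doorIndexLawFullCAtTwo_of_someDoorOffSubslice hGZ hKo hnf hHL h37 hR hZ4))

/-- **v8.14's residue gives v8.13's converse stub `DoorIndexLawLowerCAtTwo`** (AN-28c at every datum, its lower half by uniqueness of the
exponent).  Conditional by design. [cite: GrossLMS1991, Conj. 1.2 and §3] [cite: Zhang2014, Thm. 1.1] -/
theorem doorIndexLawLowerCAtTwo_of_someDoorOffSubslice
    (hGZ : ∀ (N : ℕ) [NeZero N] (W : WeierstrassCurve ℚ) (K : Type) [Field K] [NumberField K], gross_zagier N W K)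
    (hKo : ∀ (N : ℕ) [NeZero N] (W : WeierstrassCurve ℚ) (K : Type) [Field K] [NumberField K], kolyvagin N W K)
    (hnf : exists_isNewformOf) (hHL : HoffsteinLuo1997_exists_twist_L_one_ne_zero)
    (h37 : Literature.NumberTheory.EllipticCurves.GrossLMS1991.prop37_2_frobeniusCongruence)
    (hR : DoorIndexLawFullCAtTwoSomeDoorOffSubslice)
    (hZ4 : GoodOrdinaryRankZeroAtTwo ∧ MultiplicativeRankZeroAtTwo ∧ SupersingularRankZeroAtTwo ∧ AdditiveRankZeroAtTwo) :
    DoorIndexLawLowerCAtTwo :=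
  doorIndexLawLowerCAtTwo_of_full hGZ hKo hnf (doorIndexLawFullCAtTwo_of_someDoorOffSubslice hGZ hKo hnf hHL h37 hR hZ4)

/-- **AN-28c gives the hypothesis-free residue** (apply it at the datum of `exists_doorDatum_of_analyticRank_eq_one`).  Conditional on
modularity and Hoffstein–Luo (datum existence). [cite: GrossLMS1991, Conj. 1.2 and §3] [cite: HoffsteinLuo1997, Theorem (§1, pp. 435–436)] -/
theorem doorIndexLawFullCAtTwoSomeDoor_of_doorIndexLawFullCAtTwo (hnf : exists_isNewformOf)
    (hHL : HoffsteinLuo1997_exists_twist_L_one_ne_zero) (h : DoorIndexLawFullCAtTwo) : DoorIndexLawFullCAtTwoSomeDoor := by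
  intro W _ _ _ hCM hsurj hT hc hr
  obtain ⟨K, iF, iN, hK, hadm, hLt, Dt, H, ι, P, Wd, iE, iM, Cd, hP, hWd⟩ :=
    exists_doorDatum_of_analyticRank_eq_one hnf hHL W hr
  exact hasLawfulDoorAtTwo_of_doorIndexLawFullCAtTwo_at h W hCM hsurj hT hc hr K hK hadm hLt Dt H ι P hP Wd Cd hWd

/-- **v8.13's two stubs give v8.14's one — even its hypothesis-free form**: `U = U₀ (print) + OffBottom`
(`doorIndexLawUpperCAtTwo_of_bottom_of_offBottom`), AN-28c from the halves (`doorIndexLawFullCAtTwo_of_halves`: the exponent exists by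
Gross–Zagier + Kolyvagin), then the previous theorem.  Conditional by design (five printed facts). [cite: GrossLMS1991, Conj. 1.2, §3 and §10]
[cite: Kolyvagin1990, Thm. A] -/
theorem doorIndexLawFullCAtTwoSomeDoor_of_offBottom_of_lowerC
    (hGZ : ∀ (N : ℕ) [NeZero N] (W : WeierstrassCurve ℚ) (K : Type) [Field K] [NumberField K], gross_zagier N W K)
    (hKo : ∀ (N : ℕ) [NeZero N] (W : WeierstrassCurve ℚ) (K : Type) [Field K] [NumberField K], kolyvagin N W K)
    (hnf : exists_isNewformOf) (hHL : HoffsteinLuo1997_exists_twist_L_one_ne_zero)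
    (h37 : Literature.NumberTheory.EllipticCurves.GrossLMS1991.prop37_2_frobeniusCongruence)
    (hU1 : DoorIndexLawUpperCAtTwoOffBottom) (hL : DoorIndexLawLowerCAtTwo) : DoorIndexLawFullCAtTwoSomeDoor :=
  doorIndexLawFullCAtTwoSomeDoor_of_doorIndexLawFullCAtTwo hnf hHL
    (doorIndexLawFullCAtTwo_of_halves hGZ hKo hnf
      (doorIndexLawUpperCAtTwo_of_bottom_of_offBottom (doorIndexLawUpperCAtTwoBottom_of_print_ctFree hGZ hKo hnf hHL h37) hU1) hL)

/-- **v8.13's two stubs give v8.14's registered residue** (drop to the complement of the sub-slice).  Conditional by design.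
[cite: GrossLMS1991, Conj. 1.2, §3 and §10] [cite: Kolyvagin1990, Thm. A] -/
theorem doorIndexLawFullCAtTwoSomeDoorOffSubslice_of_offBottom_of_lowerC
    (hGZ : ∀ (N : ℕ) [NeZero N] (W : WeierstrassCurve ℚ) (K : Type) [Field K] [NumberField K], gross_zagier N W K)
    (hKo : ∀ (N : ℕ) [NeZero N] (W : WeierstrassCurve ℚ) (K : Type) [Field K] [NumberField K], kolyvagin N W K)
    (hnf : exists_isNewformOf) (hHL : HoffsteinLuo1997_exists_twist_L_one_ne_zero)
    (h37 : Literature.NumberTheory.EllipticCurves.GrossLMS1991.prop37_2_frobeniusCongruence)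
    (hU1 : DoorIndexLawUpperCAtTwoOffBottom) (hL : DoorIndexLawLowerCAtTwo) : DoorIndexLawFullCAtTwoSomeDoorOffSubslice :=
  doorIndexLawFullCAtTwoSomeDoorOffSubslice_of_someDoor
    (doorIndexLawFullCAtTwoSomeDoor_of_offBottom_of_lowerC hGZ hKo hnf hHL h37 hU1 hL)

/-- **The crux gives the hypothesis-free residue** (so residue, crux and AN-28c are pairwise equivalent modulo the five printed facts and
rank-`0` `BSD₂`).  Conditional by design. [cite: GrossLMS1991, Conj. 1.2 and §3] [cite: GrossZagier1986, Thm. I.6.3 and V.§2] -/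
theorem doorIndexLawFullCAtTwoSomeDoor_of_rankOneAtTwoBigImageOddLocal
    (hGZ : ∀ (N : ℕ) [NeZero N] (W : WeierstrassCurve ℚ) (K : Type) [Field K] [NumberField K], gross_zagier N W K)
    (hKo : ∀ (N : ℕ) [NeZero N] (W : WeierstrassCurve ℚ) (K : Type) [Field K] [NumberField K], kolyvagin N W K)
    (hnf : exists_isNewformOf) (hHL : HoffsteinLuo1997_exists_twist_L_one_ne_zero) (hZ : S_rankZeroTwin)
    (hX : RankOneAtTwoBigImageOddLocal) : DoorIndexLawFullCAtTwoSomeDoor := by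
  intro W _ _ _ hCM hsurj hT hc hr
  exact hasLawfulDoorAtTwo_of_bsdp_two hGZ hKo hnf hHL hZ W hCM hT hc hr (hX W hCM hsurj hT hc hr)

end Summit.BirchSwinnertonDyer.BirchSwinnertonDyer.Theorems.RankOneAtTwoOneDoor

end
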